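import Mathlib
import HarnessLib
import Summits.KontsevichZagierPeriods.Zeta5Search.SorokinConvergence

/-!
# ζ(5) search — the typed right-hand side of Zudilin's (4) is an honest integral (cell `pub-zeta5`, ct-1 g27)

HONEST FRAMING: systematic search; no irrationality claim unless kernel-certified.  A convergence statement for the TYPED
integrand of `Literature/NumberTheory/Irrationality/Zudilin2002/WellPoisedIntegrals.lean` under the TYPED hypotheses of the named
fact `Zudilin2002.vwp_eq_integral_of_pos`; nothing here is an irrationality result, a worthiness exponent or a denominator
statement; the named fact itself is NOT discharged (debt unchanged).

`SorokinConvergence.integrableOn_sorokinIntegrand` proves integrability of `∏ x_j^{a_j−1}(1−x_j)^{b_j−a_j−1} Q_k^{−a₀}` on `[0,1]^k`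
under edge and CORNER conditions.  Here the corner conditions are derived from the hypotheses of `vwp_eq_integral_of_pos` for
Zudilin's parameters `a₀ = h₁`, `a_j = h_{j+2}`, `b_j = 1 + h₀ − h_{j+3}`:

* `chain_lt` — `h₁ + h₂ + ⋯ + h_{2i+2} < (i+1)(1+h₀)` in corner form, from `h₁ + h₂ < 1 + h₀` and the pairs
  `h_j + h_{j+1} < 1 + h₀` of the printed (6);
* `sum_Icc_odd` — bookkeeping `Σ_{j=1}^{2r+3} h_j = h₁ + Σ_{m ≤ r}(h_{2m+2} + h_{2m+3})`;
* `integrableOn_sorokinIntegrand_vwp` — **for `k ≥ 1` and `h` with the printed (5), (6), `h₁ ≥ 0` and `h₁ + h₂ < 1 + h₀`, the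
  integrand of `J_k(h₁; h₂,…,h_{k+1} | 1+h₀−h₃,…,1+h₀−h_{k+2})` is integrable on `[0,1]^k`**; for odd `k` the deepest corner
  `x₀, x₂, …, x_{k−1} → 1` is governed EXACTLY by (5).

So under the hypotheses of `vwp_eq_integral_of_pos` its right-hand side `sorokinIntegral k (h 1) (h(·+2)) (1+h 0−h(·+3))` is the
integral of an integrable function (not the junk value).  Theorems only (no definitions); imports `Zeta5Search/SorokinConvergence`.
-/

noncomputable section

namespace Summit.KontsevichZagierPeriods.Zeta5Search.SorokinConvergenceVWP

open MeasureTheory Set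
open Literature.NumberTheory.Irrationality.Zudilin2002 (sorokinIntegrand)
open Summit.KontsevichZagierPeriods.Zeta5Search.SorokinConvergence

/-- **The mixed corners**: for `2i+2 ≤ k`,
`h₁ < Σ_{m ≤ i} (1 + h₀ − h_{2m+3} − h_{2m+2}) + h_{2i+3}` (i.e. `h₁ + ⋯ + h_{2i+2} < (i+1)(1+h₀)`), from `h₁ + h₂ < 1 + h₀`
and the printed (6) `h_j < 1 + h₀ − h_{j+1}` (`2 ≤ j ≤ k+1`). -/
theorem chain_lt (h : ℕ → ℝ) {k : ℕ} (h6 : ∀ j ∈ Finset.Icc 2 (k + 1), 0 < h j ∧ h j < 1 + h 0 - h (j + 1))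
    (h12 : h 1 + h 2 < 1 + h 0) :
    ∀ i : ℕ, 2 * i + 2 ≤ k →
      h 1 < (∑ m ∈ Finset.range (i + 1), (1 + h 0 - h (2 * m + 3) - h (2 * m + 2))) + h (2 * i + 1 + 2) := by
  intro i
  induction i with
  | zero =>
    intro _
    simp
    linarith
  | succ i ih =>
    intro hi
    have hprev := ih (by omega)
    have hpair := (h6 (2 * i + 3) (Finset.mem_Icc.2 ⟨by omega, by omega⟩)).2
    rw [Finset.sum_range_succ, show 2 * (i + 1) + 3 = 2 * i + 5 by ring, show 2 * (i + 1) + 2 = 2 * i + 4 by ring]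
    rw [show 2 * i + 1 + 2 = 2 * i + 3 by ring] at hprev
    rw [show 2 * i + 3 + 1 = 2 * i + 4 by ring] at hpair
    linarith

/-- Bookkeeping: `Σ_{j=1}^{2r+3} h_j = h₁ + Σ_{m ≤ r} (h_{2m+2} + h_{2m+3})`. -/
theorem sum_Icc_odd (h : ℕ → ℝ) : ∀ r : ℕ,
    ∑ j ∈ Finset.Icc 1 (2 * r + 3), h j = h 1 + ∑ m ∈ Finset.range (r + 1), (h (2 * m + 2) + h (2 * m + 3))
  | 0 => by
    have : Finset.Icc 1 (2 * 0 + 3) = {1, 2, 3} := by decide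
    rw [this]
    simp [Finset.sum_insert]
  | r + 1 => by
    rw [show 2 * (r + 1) + 3 = 2 * r + 3 + 1 + 1 by ring, Finset.sum_Icc_succ_top (by omega),
      Finset.sum_Icc_succ_top (by omega), sum_Icc_odd h r,
      Finset.sum_range_succ (fun m => h (2 * m + 2) + h (2 * m + 3)) (r + 1),
      show 2 * r + 3 + 1 + 1 = 2 * (r + 1) + 3 by ring, show 2 * r + 3 + 1 = 2 * (r + 1) + 2 by ring]
    ring

/-- **The typed right-hand side of Zudilin's (4) converges under the typed hypotheses** [Zudilin math/0206177, Theorem with (5)–(6);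
the hypotheses are those of the tree's `Zudilin2002.vwp_eq_integral_of_pos`]: for `k ≥ 1` and real `h` with
(5) `(2/(k+1)) Σ_{j=1}^{k+2} h_j < 1 + h₀`, (6) `0 < h_j < 1 + h₀ − h_{j+1}` (`2 ≤ j ≤ k+1`), `0 ≤ h₁` and `h₁ + h₂ < 1 + h₀`,
the integrand of `J_k(h₁; h₂, …, h_{k+1} | 1+h₀−h₃, …, 1+h₀−h_{k+2})` is integrable on `[0,1]^k`. -/
theorem integrableOn_sorokinIntegrand_vwp {k : ℕ} (hk : 1 ≤ k) (h : ℕ → ℝ)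
    (h5 : (2 / ((k : ℝ) + 1)) * (∑ j ∈ Finset.Icc 1 (k + 2), h j) < 1 + h 0)
    (h6 : ∀ j ∈ Finset.Icc 2 (k + 1), 0 < h j ∧ h j < 1 + h 0 - h (j + 1))
    (h1 : 0 ≤ h 1) (h12 : h 1 + h 2 < 1 + h 0) :
    IntegrableOn (sorokinIntegrand k (h 1) (fun i => h (i + 2)) (fun i => 1 + h 0 - h (i + 3)))
      (Set.pi univ fun _ : Fin k => Icc (0 : ℝ) 1) volume := by
  refine integrableOn_sorokinIntegrand hk h1 (fun j hj => ?_) (fun i hi => ?_) (fun hodd => ?_)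
  · -- edges: (6) at `j+2`
    have h' := h6 (j + 2) (Finset.mem_Icc.2 ⟨by omega, by omega⟩)
    rw [show j + 2 + 1 = j + 3 by ring] at h'
    exact ⟨h'.1, by linarith [h'.2]⟩
  · -- mixed corners
    exact chain_lt h h6 h12 i hi
  · -- the deepest corner for odd `k = 2r+1`: exactly (5)
    obtain ⟨r, rfl⟩ := hodd
    rw [show (2 * r + 1 + 1) / 2 = r + 1 by omega]
    rw [show 2 * r + 1 + 2 = 2 * r + 3 by ring, sum_Icc_odd h r] at h5
    have hpos : (0 : ℝ) < ((2 * r + 1 : ℕ) : ℝ) + 1 := by positivity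
    rw [div_mul_eq_mul_div, div_lt_iff₀ hpos] at h5
    have hcast : (1 + h 0) * (((2 * r + 1 : ℕ) : ℝ) + 1) = 2 * (((r : ℝ) + 1) * (1 + h 0)) := by push_cast; ring
    rw [hcast] at h5
    have hs : ∑ m ∈ Finset.range (r + 1), (1 + h 0 - h (2 * m + 3) - h (2 * m + 2)) =
        ((r : ℝ) + 1) * (1 + h 0) - ∑ m ∈ Finset.range (r + 1), (h (2 * m + 2) + h (2 * m + 3)) := by
      rw [eq_sub_iff_add_eq, ← Finset.sum_add_distrib,
        Finset.sum_congr rfl (fun m _ => (by ring : (1 + h 0 - h (2 * m + 3) - h (2 * m + 2)) + (h (2 * m + 2) + h (2 * m + 3)) =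
          1 + h 0)), Finset.sum_const, Finset.card_range, nsmul_eq_mul]
      push_cast
      ring
    rw [hs]
    linarith

end Summit.KontsevichZagierPeriods.Zeta5Search.SorokinConvergenceVWP

end
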